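import Summits.CriticalPhenomena.PercolationContinuityZ3.Theses.PercHollowCells

/-!
# Line `birth` — registered skeleton (BC3) for the crux `SubcritOneArmWindow`
# (stmt-CriticalPhenomena-5838, route `PercHollowCells`, rank 4)

Crux (fixed, by name): `PercHollowCells.SubcritOneArmWindow` — W, "`ν ≤ 15/16` in one-arm form":
for every `η > 0` there is `ε₀ > 0` such that for all `p ∈ (p_c − ε₀, p_c)`,
`P_p[0 ↔ ∂Λ_n] ≤ η` with `n = ⌈(p_c − p)^{−15/16}⌉₊` (bond percolation on `ℤ³`,
`{0 ↔ ∂Λ_n} = siteToBoundary 3 n`, `p_c = criticalProbI 3`).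

THE LINE ("polynomial correlation length + sharp length-to-size conversion"; it is the glued split
`SubcritOneArmWindow ⇐ XiPolynomial → SharpnessConversion → W` foreseen in the route's TWO-LAYER PLAN,
typed over the tree's rendering of the Duminil-Copin–Kozma–Tassion correlation length, i.e. the RATE
`ρ(p) := liminf_m −(1/m) log P_p[0 ↔ ∂Λ_m] = 1/ξ_p` of `Literature.Probability.Percolation.
DuminilcopinKozmaTassion2020_thm2_subcritical`, so that no new definition is needed):

* `stub_xiPolynomial` (OPEN, load-bearing — the `ν`-content): there are `ν₁ < 15/16` and `ε₁ > 0`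
  with `(p_c − p)^{ν₁} ≤ ρ(p)` for all `p ∈ (p_c − ε₁, p_c)`, i.e. `ξ_p ≤ (p_c − p)^{−ν₁}`
  eventually as `p ↑ p_c`. Numerically `ξ_p = (p_c − p)^{−ν+o(1)}`, `ν = 1/y_t = 0.8764(12)`
  (arXiv:1302.0421), margin `0.06`; rigorously only `exp(−C/(p_c − p)²) ≤ ρ(p)` is known
  (DKT 2020 Thm 2 = arXiv:1902.03207 §1.2, PROVED in the tree:
  `DuminilcopinKozmaTassion2020_thm2_subcritical_holds`). NOT implied by the conjunct `θ(p_c) = 0`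
  (in `d = 2`, `θ(p_c) = 0` holds with `ν = 4/3 > 15/16`): this stub is where the line commits to
  proving W for SUBCRITICAL reasons, as the route intends ("True in the real world for SUBCRITICAL
  reasons as soon as ξ(p_c − ε) ≤ ε^{−ν₁} eventually for some ν₁ < 15/16").
  It implies `PercReliabilityThinning.NuSupLtOne` (`ν' < 1`, axis form) given the next stub's
  engine, not conversely.
* `stub_sharpLengthBound` (provable now, M/L-sized — the "sharpness conversion"): a universal `A > 0`
  with `P_p[0 ↔ ∂Λ_n] ≤ A n² exp(−n ρ(p))` for ALL `p ∈ (0, 1]` and ALL `n ≥ 1` — the a priori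
  finite-volume bound `P_p[0 ↔ ∂B(n)] ≤ |∂B(n)| e^{−n/ξ(p)}` (Grimmett 1999 §6.2, proof of the
  existence of `ξ`: supermultiplicativity of the axis two-point function by Harris–FKG +
  translation, Fekete, the reflection trick `τ(0,x)² ≤ τ(0, 2‖x‖∞ eᵢ)` by the hyperoctahedral
  symmetry, the union bound over `∂Λ_n`, `|∂Λ_n| = 24n² + 2 ≤ 26n²`, and
  `−(1/m) log τ(0, m e₁) ≥ −(1/m) log P_p[0 ↔ ∂Λ_m]`). Tree tools: `harris_fkg_holds`,
  `AKN.real_bconn_reflect/translate/mul_le` (`BondTwoPointLowerBound.lean`),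
  `BondPercolationSymmetry.lean`, `DKT20.rate_nonneg/isBoundedUnder_rate`, Mathlib `Subadditive`.
  Why a stub and not glue: it is the one place where the LIMIT defining `ξ_p` is converted into a
  bound at the single finite scale `n(p)` UNIFORMLY in `p`, which the `liminf` alone does not give.
* `SubcritOneArmWindow_of : Stubs.stub_xiPolynomial → Stubs.stub_sharpLengthBound →
  SubcritOneArmWindow` (hypotheses the stub `Prop`s BY NAME, conclusion the route decl BY NAME;
  real proof, ≈ 90 lines of real analysis): with `ε = p_c − p`, `t = ε^{−15/16}`,
  `n = ⌈t⌉₊ ∈ [t, t+1)`, `κ = (16/15)(15/16 − ν₁) > 0`: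
  `P_p[0 ↔ ∂Λ_n] ≤ A n² e^{−n ρ(p)} ≤ A n² e^{−n ε^{ν₁}} ≤ 4A t² e^{−t^κ} = 4A s^{2/κ} e^{−s}`
  (`s = t^κ = t ε^{ν₁}`), and `s^{2/κ} e^{−s} → 0` (`tendsto_rpow_mul_exp_neg_mul_atTop_nhds_zero`);
  the thresholds are unwound to an explicit `ε₀ = min ε₁ ε₂ p_c`.

HONEST BOOKKEEPING (D-0027: "equivalence is not a defect; unexplained equivalence is"). W itself is
implied by the conjunct (`P_p ≤ P_{p_c} ↓ θ(p_c)`, retriage note 2026-08-15), hence unrefutable;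
the registered line does NOT use that: `stub_xiPolynomial` is a genuinely subcritical, refutable
(in principle: `ν ≥ 15/16` on `ℤ³` would kill it) strengthening of DKT 2020 Thm 2, strictly stronger
than what W needs at the single scale `ε^{−15/16}` but the natural statement every `ν`-engine would
deliver; `stub_sharpLengthBound` holds at every `p` (for `p ≥ p_c`, `ρ(p) = 0` and it reads
`P ≤ A n²`, trivial) and carries no critical information. Neither stub alone gives W cheaply
(stub 1 speaks of a `liminf`, W of one finite `n`; stub 2 is an identity-type bound), and neither
implies or is implied by the summit: BC3 probes `stub → SubcritOneArmWindow`, `stub → conjunct` by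
`first | exact? | simpa | aesop` fail (files `bc/*_probe*.lean` of the registering session).

DISPROOF USED: none exists for this item (`ledger crux ls stmt-CriticalPhenomena-5838`: no workfiles,
2026-08-17); no `_false_without_` theorem, no landed `Negative/` lemma to check the stubs against.
Negatives index (`ledger negatives --problem CriticalPhenomena`, 11 statements): none concerns
correlation lengths, one-arm rates or `ν`. Dead lines: none recorded for this crux.

Degenerate parameters: `p = 0` is excluded from stub 2 (`0 < p`; there `P_0[0 ↔ ∂Λ_n] = 0` for
`n ≥ 1` anyway) and `n = 0` (`Λ_0 = {0}`, `P = 1`) by `1 ≤ n`; Mathlib's `log 0 = 0` and `x/0 = 0`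
junk values only enter through `ρ`, a `liminf` of a sequence lying in `[0, −log p]` for `p > 0`
(`DKT20.rate_nonneg`, `isBoundedUnder_rate`), so `ρ(p)` is the genuine rate; `ν₁ ≤ 0` makes stub 1
claim `ρ(p) ≥ 1` near `p_c`, false (`ρ(p) → 0` as `p ↑ p_c`) but harmless to the composition; if
`p_c` were `0` the crux is vacuous (no `p < p_c` in `[0,1]`), handled explicitly in the proof.
-/

noncomputable section

namespace Summit.CriticalPhenomena.PercolationContinuityZ3.Cruxes.SubcritOneArmWindow.Birth

open MeasureTheory Filter Topology
open Literature.Probability.Percolation Literature.Probability.LatticeModels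
open Summit.CriticalPhenomena.PercolationContinuityZ3.Theses.PercHollowCells (SubcritOneArmWindow)

/-! ## Objects of the line -/

/-- `π_p(n) := P_p[0 ↔ ∂Λ_n]`, the one-arm probability of bond percolation on `ℤ³`. -/
abbrev oneArm (p : unitInterval) (n : ℕ) : ℝ :=
  (bondPercolation (zdGraph 3) p).real (siteToBoundary 3 n)

/-- `ρ(p) := liminf_m −(1/m) log P_p[0 ↔ ∂Λ_m] = 1/ξ_p`, the inverse correlation length in the
rendering of `DuminilcopinKozmaTassion2020_thm2_subcritical` (`CorrelationLengthDKT.lean`). -/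
def invCorrLength (p : unitInterval) : ℝ :=
  liminf (fun m : ℕ => -Real.log ((bondPercolation (zdGraph 3) p).real (siteToBoundary 3 m)) /
    (m : ℝ)) atTop

/-- The crux, unfolded (by `Iff.rfl`). -/
theorem subcritOneArmWindow_iff : SubcritOneArmWindow ↔
    ∀ η : ℝ, 0 < η → ∃ ε₀ : ℝ, 0 < ε₀ ∧ ∀ p : unitInterval,
      (criticalProbI 3 : ℝ) - ε₀ < (p : ℝ) → (p : ℝ) < criticalProbI 3 →
        oneArm p ⌈((criticalProbI 3 : ℝ) - (p : ℝ)) ^ (-(15 : ℝ) / 16)⌉₊ ≤ η := Iff.rfl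

/-! ## The two registered stubs: precise `Prop`s `Stubs.stub_*` + sorried theorems `stub_*` -/

namespace Stubs

/-- **Stub `Prop` 1 (`XiPolynomial`, OPEN, load-bearing)** — `ξ_p ≤ (p_c − p)^{−ν₁}` eventually,
for some `ν₁ < 15/16`, on the DKT rate: `(p_c − p)^{ν₁} ≤ liminf_m −(1/m) log P_p[0 ↔ ∂Λ_m]`
for all `p ∈ (p_c − ε₁, p_c)`. -/
def stub_xiPolynomial : Prop :=
  ∃ ν₁ : ℝ, ν₁ < 15 / 16 ∧ ∃ ε₁ : ℝ, 0 < ε₁ ∧ ∀ p : unitInterval,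
    (criticalProbI 3 : ℝ) - ε₁ < (p : ℝ) → (p : ℝ) < criticalProbI 3 →
      ((criticalProbI 3 : ℝ) - (p : ℝ)) ^ ν₁ ≤
        liminf (fun m : ℕ => -Real.log ((bondPercolation (zdGraph 3) p).real (siteToBoundary 3 m)) /
          (m : ℝ)) atTop

/-- **Stub `Prop` 2 (`SharpLengthBound`, provable now)** — the a priori finite-volume bound
`P_p[0 ↔ ∂Λ_n] ≤ A n² exp(−n/ξ_p)` for all `p ∈ (0,1]`, `n ≥ 1`, with a universal `A`
(Grimmett 1999 §6.2; `|∂Λ_n| ≤ 26 n²`). -/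
def stub_sharpLengthBound : Prop :=
  ∃ A : ℝ, 0 < A ∧ ∀ p : unitInterval, 0 < (p : ℝ) → ∀ n : ℕ, 1 ≤ n →
    (bondPercolation (zdGraph 3) p).real (siteToBoundary 3 n) ≤
      A * (n : ℝ) ^ 2 * Real.exp (-((n : ℝ) *
        liminf (fun m : ℕ => -Real.log ((bondPercolation (zdGraph 3) p).real (siteToBoundary 3 m)) /
          (m : ℝ)) atTop))

end Stubs

/-- Readable form of stub 1. -/
theorem stub_xiPolynomial_iff : Stubs.stub_xiPolynomial ↔
    ∃ ν₁ : ℝ, ν₁ < 15 / 16 ∧ ∃ ε₁ : ℝ, 0 < ε₁ ∧ ∀ p : unitInterval,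
      (criticalProbI 3 : ℝ) - ε₁ < (p : ℝ) → (p : ℝ) < criticalProbI 3 →
        ((criticalProbI 3 : ℝ) - (p : ℝ)) ^ ν₁ ≤ invCorrLength p := Iff.rfl

/-- Readable form of stub 2. -/
theorem stub_sharpLengthBound_iff : Stubs.stub_sharpLengthBound ↔
    ∃ A : ℝ, 0 < A ∧ ∀ p : unitInterval, 0 < (p : ℝ) → ∀ n : ℕ, 1 ≤ n →
      oneArm p n ≤ A * (n : ℝ) ^ 2 * Real.exp (-((n : ℝ) * invCorrLength p)) := Iff.rfl

/-- **stub 1 (registered) = `Stubs.stub_xiPolynomial` spelled out (OPEN, load-bearing).**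
Why plausibly true: `ξ_p = (p_c − p)^{−0.8764(12)+o(1)}` numerically on `ℤ³` (arXiv:1302.0421,
`ν = 1/y_t`), and every `ν₁ ∈ (ν, 15/16)` works. Why it might fail: as a THEOREM it is a nearly
sharp polynomial bound on the subcritical correlation length, far beyond the only known bound
`ξ_p ≤ exp(C (p_c − p)^{−2})` (arXiv:1902.03207 Thm 2); all differential-inequality engines
(DCT 2016 Lemma 2.1, OSSS) saturate at `ν ≤ ν/β`, i.e. give nothing below `1`. -/
theorem stub_xiPolynomial :
    ∃ ν₁ : ℝ, ν₁ < 15 / 16 ∧ ∃ ε₁ : ℝ, 0 < ε₁ ∧ ∀ p : unitInterval,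
      (criticalProbI 3 : ℝ) - ε₁ < (p : ℝ) → (p : ℝ) < criticalProbI 3 →
        ((criticalProbI 3 : ℝ) - (p : ℝ)) ^ ν₁ ≤
          liminf (fun m : ℕ => -Real.log ((bondPercolation (zdGraph 3) p).real (siteToBoundary 3 m)) /
            (m : ℝ)) atTop := by
  sorry

/-- **stub 2 (registered) = `Stubs.stub_sharpLengthBound` spelled out (provable now).**
Why true: for `x ∈ ∂Λ_n` with `|x_i| = n`, Harris–FKG, translation invariance and the reflection
fixing the `i`-th axis give `τ_p(0,x)² ≤ τ_p(0, 2n eᵢ) ≤ e^{−2n μ}` where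
`μ = inf_m −(1/m) log τ_p(0, m e₁) ≥ ρ(p)` (Fekete + `{0 ↔ m e₁} ⊆ {0 ↔ ∂Λ_m}`); sum over the
`24n² + 2 ≤ 26n²` sites of `∂Λ_n`. Size: M/L (≈ 300 lines over the tree's FKG/symmetry tools). -/
theorem stub_sharpLengthBound :
    ∃ A : ℝ, 0 < A ∧ ∀ p : unitInterval, 0 < (p : ℝ) → ∀ n : ℕ, 1 ≤ n →
      (bondPercolation (zdGraph 3) p).real (siteToBoundary 3 n) ≤
        A * (n : ℝ) ^ 2 * Real.exp (-((n : ℝ) *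
          liminf (fun m : ℕ => -Real.log ((bondPercolation (zdGraph 3) p).real (siteToBoundary 3 m)) /
            (m : ℝ)) atTop)) := by
  sorry

/-! ## Proved plumbing: the real-analysis tail estimate -/

/-- **Tail estimate.** For `ν₁ < 15/16`, `A > 0`, `η > 0` there is `ε₂ > 0` such that for every
`ε ∈ (0, ε₂]` with `ε ≤ 1` and every `n ∈ [ε^{−15/16}, ε^{−15/16} + 1)`,
`A n² exp(−n ε^{ν₁}) ≤ η`. Proof: `t = ε^{−15/16} ≥ 1`, `κ = (16/15)(15/16 − ν₁) > 0`,
`t^κ = t ε^{ν₁}`, `n ≤ 2t`, so the quantity is `≤ 4A (t^κ)^{2/κ} e^{−t^κ}`, and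
`s^{2/κ} e^{−s} → 0`. -/
theorem tail_estimate {ν₁ A η : ℝ} (hν₁ : ν₁ < 15 / 16) (hA : 0 < A) (hη : 0 < η) :
    ∃ ε₂ : ℝ, 0 < ε₂ ∧ ∀ ε : ℝ, 0 < ε → ε ≤ ε₂ → ε ≤ 1 → ∀ n : ℕ,
      ε ^ (-(15 : ℝ) / 16) ≤ n → (n : ℝ) < ε ^ (-(15 : ℝ) / 16) + 1 →
        A * (n : ℝ) ^ 2 * Real.exp (-((n : ℝ) * ε ^ ν₁)) ≤ η := by
  set κ : ℝ := (16 / 15) * (15 / 16 - ν₁) with hκdef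
  have hκ : 0 < κ := mul_pos (by norm_num) (by linarith)
  have hκne : κ ≠ 0 := hκ.ne'
  have hAne : A ≠ 0 := hA.ne'
  -- the model function `s ↦ s^(2/κ) e^{-s}` tends to `0`
  have hf : Tendsto (fun s : ℝ => s ^ (2 / κ) * Real.exp (-1 * s)) atTop (𝓝 0) :=
    tendsto_rpow_mul_exp_neg_mul_atTop_nhds_zero (2 / κ) 1 one_pos
  have hηA : 0 < η / (4 * A) := by positivity
  obtain ⟨S₀, hS₀⟩ := Filter.eventually_atTop.1 (hf.eventually (eventually_le_nhds hηA))
  set S₁ : ℝ := max S₀ 1 with hS₁def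
  have hS₁1 : 1 ≤ S₁ := le_max_right _ _
  have hS₁pos : 0 < S₁ := one_pos.trans_le hS₁1
  -- threshold on `t`: `t ≥ T := S₁^(1/κ)` gives `t^κ ≥ S₁ ≥ S₀`
  set T : ℝ := S₁ ^ (1 / κ) with hTdef
  have hT1 : 1 ≤ T := Real.one_le_rpow hS₁1 (by positivity)
  have hTpos : 0 < T := one_pos.trans_le hT1
  -- threshold on `ε`: `ε ≤ T^(-16/15)` gives `ε^(-15/16) ≥ T`
  refine ⟨T ^ (-(16 : ℝ) / 15), Real.rpow_pos_of_pos hTpos _, fun ε hε0 hεT hε1 n hn_ge hn_lt => ?_⟩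
  set t : ℝ := ε ^ (-(15 : ℝ) / 16) with htdef
  have ht1 : 1 ≤ t := Real.one_le_rpow_of_pos_of_le_one_of_nonpos hε0 hε1 (by norm_num)
  have ht0 : 0 < t := one_pos.trans_le ht1
  have htT : T ≤ t := by
    have h1 : (T ^ (-(16 : ℝ) / 15)) ^ (-(15 : ℝ) / 16) ≤ ε ^ (-(15 : ℝ) / 16) :=
      Real.rpow_le_rpow_of_nonpos hε0 hεT (by norm_num)
    have h2 : (T ^ (-(16 : ℝ) / 15)) ^ (-(15 : ℝ) / 16) = T := by
      rw [← Real.rpow_mul hTpos.le]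
      norm_num
    rwa [h2] at h1
  -- `s := t^κ ≥ S₀`
  have hsS : S₀ ≤ t ^ κ := by
    have h1 : T ^ κ ≤ t ^ κ := Real.rpow_le_rpow hTpos.le htT hκ.le
    have h2 : T ^ κ = S₁ := by
      rw [hTdef, ← Real.rpow_mul hS₁pos.le, one_div_mul_cancel hκne, Real.rpow_one]
    linarith [le_max_left S₀ 1]
  have hfs : (t ^ κ) ^ (2 / κ) * Real.exp (-1 * t ^ κ) ≤ η / (4 * A) := hS₀ (t ^ κ) hsS
  -- `(t^κ)^(2/κ) = t²` and `t^κ = t ε^{ν₁}`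
  have hpow : (t ^ κ) ^ (2 / κ) = t ^ 2 := by
    rw [← Real.rpow_mul ht0.le, show κ * (2 / κ) = 2 by field_simp, Real.rpow_two]
  have hkey : t ^ κ = t * ε ^ ν₁ := by
    rw [htdef, ← Real.rpow_mul hε0.le, ← Real.rpow_add hε0]
    congr 1
    rw [hκdef]
    ring
  -- compare
  have h3 : (n : ℝ) ^ 2 ≤ (2 * t) ^ 2 := by
    have : (n : ℝ) ≤ 2 * t := by linarith
    exact pow_le_pow_left₀ (Nat.cast_nonneg n) this 2
  have h2 : Real.exp (-((n : ℝ) * ε ^ ν₁)) ≤ Real.exp (-1 * t ^ κ) := by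
    rw [Real.exp_le_exp, hkey, neg_one_mul, neg_le_neg_iff]
    exact mul_le_mul_of_nonneg_right hn_ge (Real.rpow_nonneg hε0.le ν₁)
  calc A * (n : ℝ) ^ 2 * Real.exp (-((n : ℝ) * ε ^ ν₁))
      ≤ A * (2 * t) ^ 2 * Real.exp (-1 * t ^ κ) :=
        mul_le_mul (mul_le_mul_of_nonneg_left h3 hA.le) h2 (Real.exp_pos _).le (by positivity)
    _ = 4 * A * ((t ^ κ) ^ (2 / κ) * Real.exp (-1 * t ^ κ)) := by rw [hpow]; ring
    _ ≤ 4 * A * (η / (4 * A)) := by gcongr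
    _ = η := by field_simp

/-! ## The composition (proved): the two stubs imply the crux BY NAME -/

/-- **`SubcritOneArmWindow` from the two registered stubs** (hypotheses = the declared stub
`Prop`s by name; conclusion = the route decl `PercHollowCells.SubcritOneArmWindow` by name; no
`sorry`). `P_p[0 ↔ ∂Λ_n] ≤ A n² e^{−n ρ(p)}` (stub 2) `≤ A n² e^{−n (p_c−p)^{ν₁}}` (stub 1)
`≤ η` (tail estimate) once `p_c − p < ε₀ := min (min ε₁ ε₂) p_c`. -/
theorem SubcritOneArmWindow_of (hR : Stubs.stub_xiPolynomial) (hC : Stubs.stub_sharpLengthBound) :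
    Summit.CriticalPhenomena.PercolationContinuityZ3.Theses.PercHollowCells.SubcritOneArmWindow := by
  obtain ⟨ν₁, hν₁, ε₁, hε₁, hR⟩ := hR
  obtain ⟨A, hA, hC⟩ := hC
  intro η hη
  obtain ⟨ε₂, hε₂, hest⟩ := tail_estimate hν₁ hA hη
  by_cases hpc : (criticalProbI 3 : ℝ) ≤ 0
  · exact ⟨1, one_pos, fun p _ hlt => absurd (hlt.trans_le hpc) (not_lt.2 p.2.1)⟩
  push Not at hpc
  refine ⟨min (min ε₁ ε₂) (criticalProbI 3 : ℝ), lt_min (lt_min hε₁ hε₂) hpc, fun p hgt hlt => ?_⟩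
  have hm1 : min (min ε₁ ε₂) (criticalProbI 3 : ℝ) ≤ ε₁ := (min_le_left _ _).trans (min_le_left _ _)
  have hm2 : min (min ε₁ ε₂) (criticalProbI 3 : ℝ) ≤ ε₂ := (min_le_left _ _).trans (min_le_right _ _)
  have hm3 : min (min ε₁ ε₂) (criticalProbI 3 : ℝ) ≤ (criticalProbI 3 : ℝ) := min_le_right _ _
  have hε0 : 0 < (criticalProbI 3 : ℝ) - (p : ℝ) := sub_pos.2 hlt
  have hεle2 : (criticalProbI 3 : ℝ) - (p : ℝ) ≤ ε₂ := by linarith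
  have hε1' : (criticalProbI 3 : ℝ) - ε₁ < (p : ℝ) := by linarith
  have hp0 : 0 < (p : ℝ) := by linarith
  have hεle1 : (criticalProbI 3 : ℝ) - (p : ℝ) ≤ 1 := by
    have h1 : (criticalProbI 3 : ℝ) ≤ 1 := (criticalProbI 3).2.2
    have h2 : 0 ≤ (p : ℝ) := p.2.1
    linarith
  -- the scale `n = ⌈(p_c - p)^(-15/16)⌉₊ ≥ 1`
  have ht0 : 0 < ((criticalProbI 3 : ℝ) - (p : ℝ)) ^ (-(15 : ℝ) / 16) := Real.rpow_pos_of_pos hε0 _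
  have hn1 : 1 ≤ ⌈((criticalProbI 3 : ℝ) - (p : ℝ)) ^ (-(15 : ℝ) / 16)⌉₊ := Nat.ceil_pos.2 ht0
  have hn_ge := Nat.le_ceil (((criticalProbI 3 : ℝ) - (p : ℝ)) ^ (-(15 : ℝ) / 16))
  have hn_lt := Nat.ceil_lt_add_one ht0.le
  -- stub 2, then stub 1 inside the exponential, then the tail estimate
  refine (hC p hp0 _ hn1).trans ?_
  have hrate := hR p hε1' hlt
  refine le_trans ?_ (hest _ hε0 hεle2 hεle1 _ hn_ge hn_lt)
  refine mul_le_mul_of_nonneg_left ?_ (by positivity)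
  rw [Real.exp_le_exp, neg_le_neg_iff]
  exact mul_le_mul_of_nonneg_left hrate (Nat.cast_nonneg _)

/-- Wiring check: the registered stubs feed `SubcritOneArmWindow_of` as stated — the skeleton IS
the crux proof once the two sorries go. -/
example : Summit.CriticalPhenomena.PercolationContinuityZ3.Theses.PercHollowCells.SubcritOneArmWindow :=
  SubcritOneArmWindow_of stub_xiPolynomial stub_sharpLengthBound

end Summit.CriticalPhenomena.PercolationContinuityZ3.Cruxes.SubcritOneArmWindow.Birth

end
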